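import Summits.QuantumFields.YangMills.Theorems.BalabanUVNodesN15TwoSpacingGluingCurvedKnitCovariantLandauNodeSmall
import Summits.QuantumFields.YangMills.Theorems.BalabanUVNodesN15CovariantLandauLetterExpLeibniz
import Summits.QuantumFields.YangMills.Theorems.BalabanUVNodesN15CovariantLandauBlockMeanLipschitz
import Summits.QuantumFields.YangMills.Theorems.BalabanUVNodesN15CovariantAveragingSandwichSizes
import Summits.QuantumFields.YangMills.Theorems.BalabanUVNodesN15TwoSpacingGluingCurvedKnitSmallFieldDefect
import HarnessLib

/-!
# THE GLUING STEP AT TWO LATTICE SPACINGS — PROGRAMME (P-S), XXV: NE2⁺ (OPERATOR LAYER) FOR THE GLUED FAMILY WITH BAŁABAN's FULLY COVARIANT SUMMAND LIVE — THE LANDAU LETTER's ONE-GRID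
# ROWS FROM THE FOUR FLAT ROWS ONLY (the covariant gradient row discharged by the Leibniz route, n15-c∕224–232; the coarse Lipschitz letter by n15-c∕233a) (dag-n15-c g23, n15-c∕233)

Cell `pub-ymgap`, seat `pub-ymgap-dag-n15-c` (R134 (a); HUMAN RULING D-0062), generation 23.  `bears_on: R4∕N15 · K3⁸ SpineGivenEndpointR13SepCoPHV (stmt-QuantumFields-27366)`.
Filed `--supports stmt-QuantumFields-27366 --as helper` — COUNT-NEUTRAL.  One theorem; 0 `sorry`.  Imports BY NAME n15-c∕207b (`ne2PlusOperator_sfqr_of_global_small`), 232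
(`hasMaj_landauCov_sub_exp_of_flat''`, `landauExpThreshold2`), 233a (`norm_gavgM_sub_shift_le`), 210, 200, 215, `SiteLayerSf.norm_gavgM_le_of_norm_le`, `gavgM_conjTranspose_of_skew`,
`sfInstance_reg335_iff`, `blkFine_comp_kingPrV`.  Nothing in the tree is modified.

WHY.  n15-c∕219 displayed, per grid, four flat rows AND a covariant gradient-difference row; n15-c∕232 needs only the flat rows and the field's sizes `r` and `ℓ` ((3.35)'s first two members —
exactly what `Reg335` provides: `h1F`, `h2F`; on the coarse grid the block means inherit `nℓ ≤ r` by n15-c∕233a).  THIS FILE is the node edition: `NE2PlusOperator c₃₅ (sfInstance …) (sfqrFamily …)`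
from (`hE`) entries 1–3, (`hF`) the four FLAT rows per grid at masses `a_w·n^{d+1}`, (`hD`) the two-grid η-defect row.
* ★★★ **`ne2PlusOperator_sfqr_of_flatRows''`**.

HONEST FRAMING ∕ LIMITS.  Plumbing on MODEL carriers; the flat rows, the defect row and entries 1–3 are HYPOTHESES (the flat rows are theorems on the cover's tori by n15-c∕220∕222b —
next file); NOT [Balaban1985BackgroundPropagators] Thm 3.1∕3.14 as printed; NE2⁺ NOT PRINTED; N15 of record untouched (DISCHARGED AS CONSUMED, p687738); counts UNMOVED (typed 28∕28 ·
discharged 8∕27); one finite 𝕋⁴ at fixed ε per index — NOT infinite volume ∕ OS ∕ mass gap ∕ Clay.  Restate-immune (no Theses import).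
-/

noncomputable section

open scoped BigOperators Matrix

namespace Summit.QuantumFields.YangMills.BalabanUVNodes.N15.Gluing

open Literature.MathematicalPhysics.QuantumFieldTheory.Balaban1983to89
open Literature.MathematicalPhysics.QuantumFieldTheory.Balaban1983to89.B11SectG (BlockNorm HasMaj)
open Literature.MathematicalPhysics.QuantumFieldTheory.Balaban1983to89.T4EtaRateDefect (idef)
open Literature.MathematicalPhysics.QuantumFieldTheory.Balaban1983to89.T4EtaRateCoeffDefect (pull)
open Literature.MathematicalPhysics.QuantumFieldTheory.Balaban1983to89.B6UnitTorusCarrier (unitTorusGeo unitTorusGeo_dist_nonneg)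
open Literature.MathematicalPhysics.QuantumFieldTheory.Balaban1983to89.B5Prop11Plancherel (Tor fine unitVec)
open Literature.MathematicalPhysics.QuantumFieldTheory.Balaban1983to89.T4EtaRate (NE2PlusOperator rateFactor)
open Literature.MathematicalPhysics.QuantumFieldTheory.King1986.Torus (blockOf tdistT)
open Literature.Barriers.QuantumFields (traceForm)
open Summit.QuantumFields.YangMills.BalabanUVNodes.N15.BackgroundLayer (gavgM)
open Summit.QuantumFields.YangMills.BalabanUVNodes.N15.VectorPiece (kingPrV blkFine_comp_kingPrV bshiftEquiv)
open Summit.QuantumFields.YangMills.BalabanUVNodes.N15.MatrixSpecies (liftBlk liftMap basisConst basisConst_nonneg)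
open Summit.QuantumFields.YangMills.BalabanUVNodes.N15.OperatorReadout (opGeo)
open Summit.QuantumFields.YangMills.BalabanUVNodes.N15.CovLandau (cgrad csavg cGreen cSop landauCov landauSmallConst landauRowConst landauLetterConst_nonneg landauCov_eq_of_mass landauCov_one_eq mulVecLin_sub' cPL cAL cXL cYL)
open Summit.QuantumFields.YangMills.BalabanUVNodes.N15.CurvedSpecies (exp_smul_unitary_of_conjTranspose)
open Summit.QuantumFields.YangMills.BalabanUVNodes.N15.SiteLayerSf (norm_gavgM_le_of_norm_le)

variable {d : ℕ} {L : ℕ} [NeZero L]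

section Node

open scoped Matrix.Norms.L2Operator

variable (d) (mm ι : Type) [Fintype mm] [DecidableEq mm] [Nonempty mm] [Fintype ι] [DecidableEq ι] (e : Matrix mm mm ℂ ≃L[ℝ] (ι → ℝ))

/-- the threshold of n15-c∕232 is positive. [folklore] -/
theorem landauExpThreshold2_pos {D I κm cG cA cD cS c8 c32 δ : ℝ} (hD : 0 ≤ D) (hI : 0 ≤ I) (hκ : 0 ≤ κm) (hG : 0 ≤ cG) (hA : 0 ≤ cA) (hDc : 0 ≤ cD) (hS : 0 ≤ cS) (h8 : 0 ≤ c8) (h32 : 0 ≤ c32) :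
    0 < landauExpThreshold2 D I κm cG cA cD cS c8 c32 δ := by
  unfold landauExpThreshold2 landauSmallConst CovLandau.cK1 CovLandau.cB0 CovLandau.cM2 CovLandau.cPG0 CovLandau.cA0 cPL cAL cXL cYL
  positivity

set_option maxHeartbeats 1600000 in
/-- ★★★ **NE2⁺, OPERATOR LAYER, BY NAME — THE LANDAU LETTER's ONE-GRID ROWS FROM THE FOUR FLAT ROWS ONLY** (no covariant propagator row displayed): n15-c∕207b fed on both grids
by n15-c∕232 (letters ρ, λ, σ discharged — the Lipschitz letter λ from (3.35)'s second member: fine grid directly, coarse grid through n15-c∕233a's block-mean lemma).  Displayed: the four FLAT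
rows per grid at masses `a_w·n^{d+1}` (`hF`; theorems by n15-c∕220∕222b on the cover's tori), the two-grid η-defect row (`hD`), entries 1–3 (`hE`).  MODEL family; NOT [B9] Thm 3.1∕3.14 as printed.
[cite: Balaban1985BackgroundPropagators, Thm 3.1 (3.42) p.397, (3.49) p.399, Thm 3.4 p.400, Lemma 3.3 p.402, (3.35)–(3.37) p.396, Thm 3.14 pp.426–427; Balaban1984PropagatorsII, Props. 2.2–2.3 pp.228–231; King1986, Prop. 3.9 (3.73) p.665] -/

theorem ne2PlusOperator_sfqr_of_flatRows'' (hL : Odd L ∧ 1 < L) (hL7 : 7 ≤ L) {a : ℝ} (ha : 0 < a) {c35 : ℝ} (hc35 : 0 < c35) (he : ∀ A B : Matrix mm mm ℂ, traceForm A B = e A ⬝ᵥ e B)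
    (E : ∀ i : SfIdx d L, Fin 4 → (Fin (d + 1) → CvX' d L i.m i.kk i.r hL → Matrix mm mm ℂ) → ((CvX d L i.m i.kk hL × ι → ℝ) →ₗ[ℝ] (CvX' d L i.m i.kk i.r hL × ι → ℝ)))
    (hE : ∃ M₁ δ₁ a₁ B₁ γ₁ : ℝ, 0 < M₁ ∧ 0 < δ₁ ∧ 0 < a₁ ∧ 0 < B₁ ∧ 0 < γ₁ ∧
      ∀ i : SfIdx d L, M₁ ≤ (L : ℝ) ^ i.m → ∀ α₀ : ℝ, 0 < α₀ → (L : ℝ) ^ i.m * α₀ ≤ a₁ →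
        ∀ A' : Fin (d + 1) → CvX' d L i.m i.kk i.r hL → Matrix mm mm ℂ, (sfInstance d mm ι hL i).Bf.Reg335 c35 α₀ A' → ∀ n : Fin 4, n ≠ 0 →
          HasMaj (BlockNorm.ofBlocks (sfGeo d hL i) (liftBlk (cvBlk d L i.m i.kk hL) ι))
            (BlockNorm.ofBlocks (sfGeo d hL i) (liftBlk (cvBlk d L i.m i.kk hL ∘ kingPrV L i.kk i.r (cvM d L i.m i.kk hL)) ι)) (E i n A')
            (fun y y' => B₁ * B9.pref4 ((opGeo (sfGeo d hL i) (CvX d L i.m i.kk hL × ι) (liftBlk (cvBlk d L i.m i.kk hL) ι)).len y) n * Real.exp (-(δ₁ * (sfGeo d hL i).dist y y')) *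
              max (rateFactor (opGeo (sfGeo d hL i) (CvX d L i.m i.kk hL × ι) (liftBlk (cvBlk d L i.m i.kk hL) ι)) γ₁ y)
                (rateFactor (opGeo (sfGeo d hL i) (CvX d L i.m i.kk hL × ι) (liftBlk (cvBlk d L i.m i.kk hL) ι)) γ₁ y')))
    (hF : ∃ δF CG CA CD CS : ℝ, 0 < δF ∧ 0 ≤ CG ∧ 0 ≤ CA ∧ 0 ≤ CD ∧ 0 ≤ CS ∧ ∀ i : SfIdx d L, ∃ awC awF : ℝ, 0 < awC ∧ awC ≤ 1 ∧ 0 < awF ∧ awF ≤ 1 ∧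
        (HasMaj (BlockNorm.ofBlocks (unitTorusGeo L i.kk (cvM d L i.m i.kk hL)) (liftBlk (blockOf (L ^ i.kk) (cvM d L i.m i.kk hL)) ι)) (BlockNorm.ofBlocks (unitTorusGeo L i.kk (cvM d L i.m i.kk hL)) (liftBlk (blockOf (L ^ i.kk) (cvM d L i.m i.kk hL)) ι)) (Matrix.mulVecLin (cGreen (cvM d L i.m i.kk hL) (L ^ i.kk) (fun (_ : Fin (d + 1)) (_ : Tor (fine (L ^ i.kk) (cvM d L i.m i.kk hL))) => (1 : Matrix ι ι ℝ)) (awC * ((L ^ i.kk : ℕ) : ℝ) ^ (d + 1)))) (fun y y' => CG * Real.exp (-(δF * (unitTorusGeo L i.kk (cvM d L i.m i.kk hL)).dist y y'))) ∧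
          HasMaj (BlockNorm.ofBlocks (unitTorusGeo L i.kk (cvM d L i.m i.kk hL)) (liftBlk (fun b : Tor (fine (L ^ i.kk) (cvM d L i.m i.kk hL)) × Fin (d + 1) => blockOf (L ^ i.kk) (cvM d L i.m i.kk hL) b.1) ι)) (BlockNorm.ofBlocks (unitTorusGeo L i.kk (cvM d L i.m i.kk hL)) (liftBlk (blockOf (L ^ i.kk) (cvM d L i.m i.kk hL)) ι)) (Matrix.mulVecLin (cGreen (cvM d L i.m i.kk hL) (L ^ i.kk) (fun (_ : Fin (d + 1)) (_ : Tor (fine (L ^ i.kk) (cvM d L i.m i.kk hL))) => (1 : Matrix ι ι ℝ)) (awC * ((L ^ i.kk : ℕ) : ℝ) ^ (d + 1)) * (cgrad (cvM d L i.m i.kk hL) (L ^ i.kk) (fun (_ : Fin (d + 1)) (_ : Tor (fine (L ^ i.kk) (cvM d L i.m i.kk hL))) => (1 : Matrix ι ι ℝ)))ᵀ)) (fun y y' => CA * Real.exp (-(δF * (unitTorusGeo L i.kk (cvM d L i.m i.kk hL)).dist y y'))) ∧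
          HasMaj (BlockNorm.ofBlocks (unitTorusGeo L i.kk (cvM d L i.m i.kk hL)) (liftBlk (blockOf (L ^ i.kk) (cvM d L i.m i.kk hL)) ι)) (BlockNorm.ofBlocks (unitTorusGeo L i.kk (cvM d L i.m i.kk hL)) (liftBlk (fun b : Tor (fine (L ^ i.kk) (cvM d L i.m i.kk hL)) × Fin (d + 1) => blockOf (L ^ i.kk) (cvM d L i.m i.kk hL) b.1) ι)) (Matrix.mulVecLin (cgrad (cvM d L i.m i.kk hL) (L ^ i.kk) (fun (_ : Fin (d + 1)) (_ : Tor (fine (L ^ i.kk) (cvM d L i.m i.kk hL))) => (1 : Matrix ι ι ℝ)) * cGreen (cvM d L i.m i.kk hL) (L ^ i.kk) (fun (_ : Fin (d + 1)) (_ : Tor (fine (L ^ i.kk) (cvM d L i.m i.kk hL))) => (1 : Matrix ι ι ℝ)) (awC * ((L ^ i.kk : ℕ) : ℝ) ^ (d + 1)))) (fun y y' => CD * Real.exp (-(δF * (unitTorusGeo L i.kk (cvM d L i.m i.kk hL)).dist y y'))) ∧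
          HasMaj (BlockNorm.ofBlocks (unitTorusGeo L i.kk (cvM d L i.m i.kk hL)) (liftBlk (fun y : Tor (cvM d L i.m i.kk hL) => y) ι)) (BlockNorm.ofBlocks (unitTorusGeo L i.kk (cvM d L i.m i.kk hL)) (liftBlk (fun y : Tor (cvM d L i.m i.kk hL) => y) ι)) (Matrix.mulVecLin (cSop (cvM d L i.m i.kk hL) (L ^ i.kk) (fun (_ : Fin (d + 1)) (_ : Tor (fine (L ^ i.kk) (cvM d L i.m i.kk hL))) => (1 : Matrix ι ι ℝ)) (awC * ((L ^ i.kk : ℕ) : ℝ) ^ (d + 1)))⁻¹) (fun y y' => CS * ((L ^ i.kk : ℕ) : ℝ) ^ (d + 1) * Real.exp (-(δF * (unitTorusGeo L i.kk (cvM d L i.m i.kk hL)).dist y y')))) ∧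
        (HasMaj (BlockNorm.ofBlocks (unitTorusGeo L i.kk (cvM d L i.m i.kk hL)) (liftBlk (blockOf (L ^ i.r * L ^ i.kk) (cvM d L i.m i.kk hL)) ι)) (BlockNorm.ofBlocks (unitTorusGeo L i.kk (cvM d L i.m i.kk hL)) (liftBlk (blockOf (L ^ i.r * L ^ i.kk) (cvM d L i.m i.kk hL)) ι)) (Matrix.mulVecLin (cGreen (cvM d L i.m i.kk hL) (L ^ i.r * L ^ i.kk) (fun (_ : Fin (d + 1)) (_ : Tor (fine (L ^ i.r * L ^ i.kk) (cvM d L i.m i.kk hL))) => (1 : Matrix ι ι ℝ)) (awF * ((L ^ i.r * L ^ i.kk : ℕ) : ℝ) ^ (d + 1)))) (fun y y' => CG * Real.exp (-(δF * (unitTorusGeo L i.kk (cvM d L i.m i.kk hL)).dist y y'))) ∧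
          HasMaj (BlockNorm.ofBlocks (unitTorusGeo L i.kk (cvM d L i.m i.kk hL)) (liftBlk (fun b : Tor (fine (L ^ i.r * L ^ i.kk) (cvM d L i.m i.kk hL)) × Fin (d + 1) => blockOf (L ^ i.r * L ^ i.kk) (cvM d L i.m i.kk hL) b.1) ι)) (BlockNorm.ofBlocks (unitTorusGeo L i.kk (cvM d L i.m i.kk hL)) (liftBlk (blockOf (L ^ i.r * L ^ i.kk) (cvM d L i.m i.kk hL)) ι)) (Matrix.mulVecLin (cGreen (cvM d L i.m i.kk hL) (L ^ i.r * L ^ i.kk) (fun (_ : Fin (d + 1)) (_ : Tor (fine (L ^ i.r * L ^ i.kk) (cvM d L i.m i.kk hL))) => (1 : Matrix ι ι ℝ)) (awF * ((L ^ i.r * L ^ i.kk : ℕ) : ℝ) ^ (d + 1)) * (cgrad (cvM d L i.m i.kk hL) (L ^ i.r * L ^ i.kk) (fun (_ : Fin (d + 1)) (_ : Tor (fine (L ^ i.r * L ^ i.kk) (cvM d L i.m i.kk hL))) => (1 : Matrix ι ι ℝ)))ᵀ)) (fun y y' => CA * Real.exp (-(δF * (unitTorusGeo L i.kk (cvM d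 L i.m i.kk hL)).dist y y'))) ∧
          HasMaj (BlockNorm.ofBlocks (unitTorusGeo L i.kk (cvM d L i.m i.kk hL)) (liftBlk (blockOf (L ^ i.r * L ^ i.kk) (cvM d L i.m i.kk hL)) ι)) (BlockNorm.ofBlocks (unitTorusGeo L i.kk (cvM d L i.m i.kk hL)) (liftBlk (fun b : Tor (fine (L ^ i.r * L ^ i.kk) (cvM d L i.m i.kk hL)) × Fin (d + 1) => blockOf (L ^ i.r * L ^ i.kk) (cvM d L i.m i.kk hL) b.1) ι)) (Matrix.mulVecLin (cgrad (cvM d L i.m i.kk hL) (L ^ i.r * L ^ i.kk) (fun (_ : Fin (d + 1)) (_ : Tor (fine (L ^ i.r * L ^ i.kk) (cvM d L i.m i.kk hL))) => (1 : Matrix ι ι ℝ)) * cGreen (cvM d L i.m i.kk hL) (L ^ i.r * L ^ i.kk) (fun (_ : Fin (d + 1)) (_ : Tor (fine (L ^ i.r * L ^ i.kk) (cvM d L i.m i.kk hL))) => (1 : Matrix ι ι ℝ)) (awF * ((L ^ i.r * L ^ i.kk : ℕ) : ℝ) ^ (d + 1)))) (fun y y' => CD * Real.exp (-(δF * (unitTorusGeo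 L i.kk (cvM d L i.m i.kk hL)).dist y y'))) ∧
          HasMaj (BlockNorm.ofBlocks (unitTorusGeo L i.kk (cvM d L i.m i.kk hL)) (liftBlk (fun y : Tor (cvM d L i.m i.kk hL) => y) ι)) (BlockNorm.ofBlocks (unitTorusGeo L i.kk (cvM d L i.m i.kk hL)) (liftBlk (fun y : Tor (cvM d L i.m i.kk hL) => y) ι)) (Matrix.mulVecLin (cSop (cvM d L i.m i.kk hL) (L ^ i.r * L ^ i.kk) (fun (_ : Fin (d + 1)) (_ : Tor (fine (L ^ i.r * L ^ i.kk) (cvM d L i.m i.kk hL))) => (1 : Matrix ι ι ℝ)) (awF * ((L ^ i.r * L ^ i.kk : ℕ) : ℝ) ^ (d + 1)))⁻¹) (fun y y' => CS * ((L ^ i.r * L ^ i.kk : ℕ) : ℝ) ^ (d + 1) * Real.exp (-(δF * (unitTorusGeo L i.kk (cvM d L i.m i.kk hL)).dist y y')))))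
    (hD : ∃ δD CR γR aD : ℝ, 0 < δD ∧ 0 ≤ CR ∧ 0 < γR ∧ 0 < aD ∧
      ∀ i : SfIdx d L, ∀ α₀ : ℝ, 0 < α₀ → (L : ℝ) ^ i.m * α₀ ≤ aD → ∀ A' : Fin (d + 1) → CvX' d L i.m i.kk i.r hL → Matrix mm mm ℂ, (sfInstance d mm ι hL i).Bf.Reg335 c35 α₀ A' →
        HasMaj (CvNorm d L i.m i.kk hL ι) (BlockNorm.ofBlocks (unitTorusGeo L i.kk (cvM d L i.m i.kk hL)) (liftBlk (cvBlk d L i.m i.kk hL ∘ (kingPrV L i.kk i.r (cvM d L i.m i.kk hL))) ι)) (idef (pull (liftMap (kingPrV L i.kk i.r (cvM d L i.m i.kk hL)) ι)) (pull (liftMap (kingPrV L i.kk i.r (cvM d L i.m i.kk hL)) ι)) (cvNVr' d L i.m i.kk i.r hL a ι e (fun μ x' => NormedSpace.exp (((((L ^ i.r * L ^ i.kk : ℕ) : ℝ))⁻¹) • A' μ x'))) (cvNVr d L i.m i.kk hL a ι e (fun μ x => NormedSpace.exp (((((L ^ i.kk : ℕ) : ℝ))⁻¹) • gavgM (Matrix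 mm mm ℂ) (Fin (d + 1)) (kingPrV L i.kk i.r (cvM d L i.m i.kk hL)) A' μ x)))) (fun y y' => (CR * ((L : ℝ) ^ i.kk) ^ (-γR)) * Real.exp (-(δD * (unitTorusGeo L i.kk (cvM d L i.m i.kk hL)).dist y y')))) :
    NE2PlusOperator c35 (sfInstance d mm ι hL) (fun i => sfqrFamily d mm ι a e hL i (E i)) := by
  obtain ⟨δF, CG, CA, CD, CS, hδF, hCG, hCA, hCD, hCS, hF⟩ := hF
  obtain ⟨δD, CR, γR, aD, hδD, hCR, hγR, haD, hD⟩ := hD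
  have hLpos : 0 < L := Nat.pos_of_ne_zero (NeZero.ne L)
  have hLr : (0 : ℝ) < (L : ℝ) := Nat.cast_pos.mpr hLpos
  -- the constants of n15-c∕218 (index-free)
  have hκF := @basisConst_nonneg ι _ (Matrix mm mm ℂ) Matrix.frobeniusNormedAddCommGroup Matrix.frobeniusNormedSpace e
  have hκm : (0 : ℝ) ≤ (@basisConst ι _ (Matrix mm mm ℂ) Matrix.frobeniusNormedAddCommGroup Matrix.frobeniusNormedSpace e * (2 * Real.sqrt (Fintype.card mm)) * Real.sqrt (Fintype.card mm)) := by positivity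
  have hcs8 : 0 ≤ B4Sect5Proof.latticeConst (d + 1) (δF / 8) := B4Sect5Proof.latticeConst_nonneg (d + 1) (by positivity)
  have hcs : 0 ≤ B4Sect5Proof.latticeConst (d + 1) (δF / 2 / 16) := B4Sect5Proof.latticeConst_nonneg (d + 1) (by positivity)
  have hcs' : 0 ≤ B4Sect5Proof.latticeConst (d + 1) (3 * (δF / 2) / 4 / 8) := B4Sect5Proof.latticeConst_nonneg (d + 1) (by positivity)
  have hthr : 0 < landauExpThreshold2 ((d : ℝ) + 1) (Fintype.card ι) (@basisConst ι _ (Matrix mm mm ℂ) Matrix.frobeniusNormedAddCommGroup Matrix.frobeniusNormedSpace e * (2 * Real.sqrt (Fintype.card mm)) * Real.sqrt (Fintype.card mm)) CG CA CD CS (B4Sect5Proof.latticeConst (d + 1) (δF / 8)) (B4Sect5Proof.latticeConst (d + 1) (δF / 2 / 16)) δF :=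
    landauExpThreshold2_pos (by positivity) (Nat.cast_nonneg _) hκm hCG hCA hCD hCS hcs8 hcs
  have hcR : 0 ≤ landauRowConst ((d : ℝ) + 1) (Fintype.card ι) CG CA CD CS (cPL ((d : ℝ) + 1) CG CD (2 * Fintype.card ι * (@basisConst ι _ (Matrix mm mm ℂ) Matrix.frobeniusNormedAddCommGroup Matrix.frobeniusNormedSpace e * (2 * Real.sqrt (Fintype.card mm)) * Real.sqrt (Fintype.card mm))) (Real.exp 1 * Fintype.card ι * (@basisConst ι _ (Matrix mm mm ℂ) Matrix.frobeniusNormedAddCommGroup Matrix.frobeniusNormedSpace e * (2 * Real.sqrt (Fintype.card mm)) * Real.sqrt (Fintype.card mm))) (2 * ((d : ℝ) + 1) * (2 * Fintype.card ι * (@basisConst ι _ (Matrix mm mm ℂ) Matrix.frobeniusNormedAddCommGroup Matrix.frobeniusNormedSpace e * (2 * Real.sqrt (Fintype.card mm)) * Real.sqrt (Fintype.card mm)))) 1 (B4Sect5Proof.latticeConst (d + 1) (δF / 8)) δF (δF / 8)) (2 * Fintype.card ι * (@basisConst ι _ (Matrix mm mm ℂ) Matrix.frobeniusNormedAddCommGroup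 Matrix.frobeniusNormedSpace e * (2 * Real.sqrt (Fintype.card mm)) * Real.sqrt (Fintype.card mm))) (2 * ((d : ℝ) + 1) * (2 * Fintype.card ι * (@basisConst ι _ (Matrix mm mm ℂ) Matrix.frobeniusNormedAddCommGroup Matrix.frobeniusNormedSpace e * (2 * Real.sqrt (Fintype.card mm)) * Real.sqrt (Fintype.card mm)))) 1
      (B4Sect5Proof.latticeConst (d + 1) (δF / 2 / 16)) (B4Sect5Proof.latticeConst (d + 1) (3 * (δF / 2) / 4 / 8)) (δF / 2) := by
    unfold landauRowConst
    have hP0 : 0 ≤ (cPL ((d : ℝ) + 1) CG CD (2 * Fintype.card ι * (@basisConst ι _ (Matrix mm mm ℂ) Matrix.frobeniusNormedAddCommGroup Matrix.frobeniusNormedSpace e * (2 * Real.sqrt (Fintype.card mm)) * Real.sqrt (Fintype.card mm))) (Real.exp 1 * Fintype.card ι * (@basisConst ι _ (Matrix mm mm ℂ) Matrix.frobeniusNormedAddCommGroup Matrix.frobeniusNormedSpace e * (2 * Real.sqrt (Fintype.card mm)) * Real.sqrt (Fintype.card mm))) (2 * ((d : ℝ) + 1) * (2 * Fintype.card ι *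 (@basisConst ι _ (Matrix mm mm ℂ) Matrix.frobeniusNormedAddCommGroup Matrix.frobeniusNormedSpace e * (2 * Real.sqrt (Fintype.card mm)) * Real.sqrt (Fintype.card mm)))) 1 (B4Sect5Proof.latticeConst (d + 1) (δF / 8)) δF (δF / 8)) := by unfold cPL cAL cYL; positivity
    exact landauLetterConst_nonneg (by positivity) (by positivity) hcs' (by positivity) (by unfold CovLandau.cM2 CovLandau.cA0; positivity) hCD hP0
      (by unfold CovLandau.cPG0 CovLandau.cA0; positivity) (by norm_num) (by positivity)
  refine ne2PlusOperator_sfqr_of_global_small d mm ι e hL hL7 ha hc35 he E hE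
    ⟨min (3 * (δF / 2) / 8) δD, _, CR, γR, min aD ((landauExpThreshold2 ((d : ℝ) + 1) (Fintype.card ι) (@basisConst ι _ (Matrix mm mm ℂ) Matrix.frobeniusNormedAddCommGroup Matrix.frobeniusNormedSpace e * (2 * Real.sqrt (Fintype.card mm)) * Real.sqrt (Fintype.card mm)) CG CA CD CS (B4Sect5Proof.latticeConst (d + 1) (δF / 8)) (B4Sect5Proof.latticeConst (d + 1) (δF / 2 / 16)) δF / c35)),
      lt_min (by positivity) hδD, hcR, hCR, hγR, lt_min haD (by positivity), fun i α₀ hα₀ hMa A' hA' => ?_⟩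
  -- the class, the sizes
  have hMaD : (L : ℝ) ^ i.m * α₀ ≤ aD := hMa.trans (min_le_left _ _)
  have hMaT : (L : ℝ) ^ i.m * α₀ ≤ landauExpThreshold2 ((d : ℝ) + 1) (Fintype.card ι) (@basisConst ι _ (Matrix mm mm ℂ) Matrix.frobeniusNormedAddCommGroup Matrix.frobeniusNormedSpace e * (2 * Real.sqrt (Fintype.card mm)) * Real.sqrt (Fintype.card mm)) CG CA CD CS (B4Sect5Proof.latticeConst (d + 1) (δF / 8)) (B4Sect5Proof.latticeConst (d + 1) (δF / 2 / 16)) δF / c35 :=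
    hMa.trans (min_le_right _ _)
  have hrA0 : 0 ≤ c35 * (L : ℝ) ^ i.m * α₀ := by positivity
  have hrT : c35 * (L : ℝ) ^ i.m * α₀ ≤ landauExpThreshold2 ((d : ℝ) + 1) (Fintype.card ι) (@basisConst ι _ (Matrix mm mm ℂ) Matrix.frobeniusNormedAddCommGroup Matrix.frobeniusNormedSpace e * (2 * Real.sqrt (Fintype.card mm)) * Real.sqrt (Fintype.card mm)) CG CA CD CS (B4Sect5Proof.latticeConst (d + 1) (δF / 8)) (B4Sect5Proof.latticeConst (d + 1) (δF / 2 / 16)) δF := by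
    have := mul_le_mul_of_nonneg_left hMaT hc35.le
    rw [mul_div_cancel₀ _ hc35.ne'] at this
    simpa only [mul_assoc] using this
  obtain ⟨hskew, h1F, h2F, h3F⟩ := (sfInstance_reg335_iff d mm ι hL i c35 α₀ A').1 hA'
  have h1 : ∀ μ x', ‖A' μ x'‖ ≤ c35 * (L : ℝ) ^ i.m * α₀ := fun μ x' => (l2_opNorm_le_frobenius_norm _).trans (h1F μ x')
  have hĀs : ∀ μ x, (gavgM (Matrix mm mm ℂ) (Fin (d + 1)) (kingPrV L i.kk i.r (cvM d L i.m i.kk hL)) A' μ x)ᴴ = -gavgM (Matrix mm mm ℂ) (Fin (d + 1)) (kingPrV L i.kk i.r (cvM d L i.m i.kk hL)) A' μ x :=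
    fun μ x => gavgM_conjTranspose_of_skew (kingPrV L i.kk i.r (cvM d L i.m i.kk hL)) hskew μ x
  have hĀ : ∀ μ x, ‖gavgM (Matrix mm mm ℂ) (Fin (d + 1)) (kingPrV L i.kk i.r (cvM d L i.m i.kk hL)) A' μ x‖ ≤ c35 * (L : ℝ) ^ i.m * α₀ :=
    fun μ x => (l2_opNorm_le_frobenius_norm _).trans (norm_gavgM_le_of_norm_le d mm hL i hrA0 h1F μ x)
  obtain ⟨awC, awF, hawC0, hawC1, hawF0, hawF1, ⟨hG1c, hA1c, hD1c, hS1c⟩, ⟨hG1f, hA1f, hD1f, hS1f⟩⟩ := hF i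
  -- the Lipschitz sizes ((3.35)'s second member): fine `ℓ′ = r/n′`, coarse `ℓ = L^r·ℓ′` (block means, n15-c∕233a)
  have hb0 : 0 ≤ c35 * (L : ℝ) ^ i.m * α₀ * (((L : ℝ) ^ i.kk)⁻¹ * ((L : ℝ) ^ i.r)⁻¹) := by positivity
  have h2 : ∀ μ κ x', ‖A' μ (bshiftEquiv (cvM d L i.m i.kk hL) (L ^ i.r * L ^ i.kk) κ x') - A' μ x'‖ ≤ c35 * (L : ℝ) ^ i.m * α₀ * (((L : ℝ) ^ i.kk)⁻¹ * ((L : ℝ) ^ i.r)⁻¹) :=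
    fun μ κ x' => (l2_opNorm_le_frobenius_norm _).trans (h2F μ κ x')
  have hℓf : ∀ μ (z : Tor (fine (L ^ i.r * L ^ i.kk) (cvM d L i.m i.kk hL))), ‖A' μ (z, μ) - A' μ (z - unitVec (fine (L ^ i.r * L ^ i.kk) (cvM d L i.m i.kk hL)) μ, μ)‖ ≤
      c35 * (L : ℝ) ^ i.m * α₀ * (((L : ℝ) ^ i.kk)⁻¹ * ((L : ℝ) ^ i.r)⁻¹) := by
    intro μ z
    have h := h2 μ μ (z - unitVec (fine (L ^ i.r * L ^ i.kk) (cvM d L i.m i.kk hL)) μ, μ)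
    simpa [bshiftEquiv] using h
  have hℓc : ∀ μ (z : Tor (fine (L ^ i.kk) (cvM d L i.m i.kk hL))), ‖gavgM (Matrix mm mm ℂ) (Fin (d + 1)) (kingPrV L i.kk i.r (cvM d L i.m i.kk hL)) A' μ (z, μ) -
      gavgM (Matrix mm mm ℂ) (Fin (d + 1)) (kingPrV L i.kk i.r (cvM d L i.m i.kk hL)) A' μ (z - unitVec (fine (L ^ i.kk) (cvM d L i.m i.kk hL)) μ, μ)‖ ≤
      (L ^ i.r : ℕ) * (c35 * (L : ℝ) ^ i.m * α₀ * (((L : ℝ) ^ i.kk)⁻¹ * ((L : ℝ) ^ i.r)⁻¹)) :=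
    fun μ z => norm_gavgM_sub_shift_le (cvM d L i.m i.kk hL) i.kk i.r A' h2 μ μ μ z
  have hnℓf : ((L ^ i.r * L ^ i.kk : ℕ) : ℝ) * (c35 * (L : ℝ) ^ i.m * α₀ * (((L : ℝ) ^ i.kk)⁻¹ * ((L : ℝ) ^ i.r)⁻¹)) ≤ c35 * (L : ℝ) ^ i.m * α₀ := by
    have hk : (0 : ℝ) < (L : ℝ) ^ i.kk := pow_pos hLr _
    have hr' : (0 : ℝ) < (L : ℝ) ^ i.r := pow_pos hLr _
    refine le_of_eq ?_
    push_cast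
    field_simp
  have hnℓc : ((L ^ i.kk : ℕ) : ℝ) * ((L ^ i.r : ℕ) * (c35 * (L : ℝ) ^ i.m * α₀ * (((L : ℝ) ^ i.kk)⁻¹ * ((L : ℝ) ^ i.r)⁻¹))) ≤ c35 * (L : ℝ) ^ i.m * α₀ := by
    have hk : (0 : ℝ) < (L : ℝ) ^ i.kk := pow_pos hLr _
    have hr' : (0 : ℝ) < (L : ℝ) ^ i.r := pow_pos hLr _
    refine le_of_eq ?_
    push_cast
    field_simp
  -- n15-c∕232 on both grids
  have keyC := hasMaj_landauCov_sub_exp_of_flat'' (cvM d L i.m i.kk hL) (L ^ i.kk) L i.kk e hawC0 hawC1 hĀs hrA0 (by positivity) hĀ hℓc hnℓc hδF hCG hCA hCD hCS hG1c hA1c hD1c hS1c hrT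
  have keyF := hasMaj_landauCov_sub_exp_of_flat'' (cvM d L i.m i.kk hL) (L ^ i.r * L ^ i.kk) L i.kk e hawF0 hawF1 hskew hrA0 hb0 h1 hℓf hnℓf hδF hCG hCA hCD hCS hG1f hA1f hD1f hS1f hrT
  have hd0 := unitTorusGeo_dist_nonneg L i.kk (cvM d L i.m i.kk hL)
  -- unitarity and masses
  have hUc : ∀ ν (p : CvX d L i.m i.kk hL), ((fun μ x => NormedSpace.exp (((((L ^ i.kk : ℕ) : ℝ))⁻¹) • gavgM (Matrix mm mm ℂ) (Fin (d + 1)) (kingPrV L i.kk i.r (cvM d L i.m i.kk hL)) A' μ x)) ν p)ᴴ * (fun μ x => NormedSpace.exp (((((L ^ i.kk : ℕ) : ℝ))⁻¹) • gavgM (Matrix mm mm ℂ) (Fin (d + 1)) (kingPrV L i.kk i.r (cvM d L i.m i.kk hL)) A' μ x)) ν p = 1 := fun ν p => exp_smul_unitary_of_conjTranspose (hĀs ν p) _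
  have hUf : ∀ ν (p : CvX' d L i.m i.kk i.r hL), ((fun μ x' => NormedSpace.exp (((((L ^ i.r * L ^ i.kk : ℕ) : ℝ))⁻¹) • A' μ x')) ν p)ᴴ * (fun μ x' => NormedSpace.exp (((((L ^ i.r * L ^ i.kk : ℕ) : ℝ))⁻¹) • A' μ x')) ν p = 1 := fun ν p => exp_smul_unitary_of_conjTranspose (hskew ν p) _
  have hTc := isUnit_cvT₀ e hUc
  have hTf := isUnit_cvT₀ e hUf
  have haC : (0 : ℝ) < (awC * ((L ^ i.kk : ℕ) : ℝ) ^ (d + 1)) := mul_pos hawC0 (pow_pos (Nat.cast_pos.mpr (pow_pos hLpos _)) _)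
  have haF : (0 : ℝ) < (awF * ((L ^ i.r * L ^ i.kk : ℕ) : ℝ) ^ (d + 1)) := mul_pos hawF0 (pow_pos (Nat.cast_pos.mpr (Nat.mul_pos (pow_pos hLpos _) (pow_pos hLpos _))) _)
  refine ⟨?_, ?_, ?_⟩
  · -- the coarse global row
    rw [cvNVr, cvLandau, landauCov_eq_of_mass _ _ hTc ha haC, ← landauCov_one_eq _ _ haC ι, ← mulVecLin_sub']
    exact keyC.of_rate_le hd0 (mul_nonneg hcR hrA0) (min_le_left _ _)
  · -- the fine global row: the knit's fine block map IS King's block map at the fine spacing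
    have hBN : BlockNorm.ofBlocks (unitTorusGeo L i.kk (cvM d L i.m i.kk hL)) (liftBlk (cvBlk d L i.m i.kk hL ∘ (kingPrV L i.kk i.r (cvM d L i.m i.kk hL))) ι) =
        BlockNorm.ofBlocks (unitTorusGeo L i.kk (cvM d L i.m i.kk hL)) (liftBlk (fun b : Tor (fine (L ^ i.r * L ^ i.kk) (cvM d L i.m i.kk hL)) × Fin (d + 1) => blockOf (L ^ i.r * L ^ i.kk) (cvM d L i.m i.kk hL) b.1) ι) := by
      congr 1
      funext p
      exact congrFun (blkFine_comp_kingPrV (cvM d L i.m i.kk hL) L i.kk i.r) p.1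
    rw [hBN, cvNVr', cvLandau', landauCov_eq_of_mass _ _ hTf ha haF, ← landauCov_one_eq _ _ haF ι, ← mulVecLin_sub']
    exact keyF.of_rate_le hd0 (mul_nonneg hcR hrA0) (min_le_left _ _)
  · -- the two-grid defect row (displayed)
    exact (hD i α₀ hα₀ hMaD A' hA').of_rate_le hd0 (mul_nonneg hCR (Real.rpow_nonneg (pow_pos hLr _).le _)) (min_le_right _ _)

end Node

end Summit.QuantumFields.YangMills.BalabanUVNodes.N15.Gluing

end
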